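import Literature.Probability.RandomPlanarGeometry.SLERestrictionProcessesKappa
import Literature.Probability.RandomPlanarGeometry.TranslatedHullJets
import Literature.Probability.RandomPlanarGeometry.StarHullSubStep
import Literature.Probability.Process.RightContinuousProgressive
import Literature.Analysis.FunctionSpaces.ItoProcessesProofs
import HarnessLib

/-!
# The compensator `∫₀ᵗ m(A_s − W_s) ds` of [LSW] Prop. 5.3 along SLE_κ: the mass process and its time integral

General-`κ` infrastructure for the martingale `Y_t = h_t′(W_t)^α exp(λ ∫₀ᵗ Sh_s(W_s)/6 ds)` of

* G. F. Lawler, O. Schramm, W. Werner, *Conformal restriction: the chordal case*, J. Amer. Math.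
  Soc. **16** (2003) 917–955, arXiv:math/0209343 (**[LSW]**), §5 Prop. 5.3 and §6 Thm. 6.5, whose
  compensator is `exp(−λ ∫₀ᵗ m(A_s − W_s) ds)` with the Schwarzian mass
  `m(B) = −SΦ_B(0)/6 = Φ_B″(0)²/(4Φ_B′(0)²) − Φ_B‴(0)/(6Φ_B′(0))` (`starBubbleMass`, (7.2)) of the slid
  hull `A_s − W_s`.

On the path space `C(ℝ≥0, ℝ)` with driver `drvK κ υ = √κ (υ − υ 0)` (`SLERestrictionProcessesKappa`):

* `MFnK κ A s υ = 𝟙{alive at s} · m(A_s − W_s)` — nonnegative (`MFnK_nonneg`, [LSW] (5.1): the mass is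
  a half-plane capacity, `StarHullSubStep`/`SchwarzianCapacity`), bounded on the controlled class,
  measurable in the path (`measurable_MFnK`, `TranslatedHullJets`), and — the analytic point of this
  file — **right-continuous in time for every path** (`continuousWithinAt_MFnK`: at an alive time
  the one-step estimate `|m(B′) − m(B)| ≤ massStepC (u + η)` of `StarHullOneStepMass` with the semigroup
  identity `A_{s+u} − W_{s+u} = (A_s − W_s)′` of `SLERestrictionStepAlive`; after the death time the
  functional vanishes identically);
* on the Wiener space, `MpK κ A s ω = MFnK κ A s (β ω)` is adapted with right-continuous paths, hence
  (strongly) **progressively measurable** (`isStronglyProgressive_MpK`, Karatzas–Shreve Prop. 1.1.13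
  as `Process.isStronglyProgressive_of_rightContinuous`), with measurable paths;
* the compensator stopped at the localising time `Tₙ` (`locTimeK`):
  `IpnK κ hA hne n = timeIntegral (trunc Tₙ (MpK κ A))`, i.e. `t ↦ ∫₀^{t} 𝟙{s ≤ Tₙ} m(A_s − W_s) ds` —
  adapted (`adapted_IpnK`, Fubini measurability `adapted_timeIntegral`), with continuous, nonnegative,
  monotone paths (`continuous_IpnK`, `IpnK_nonneg`, `IpnK_mono`), the integrand being bounded by
  `massBdK (locLevel n)` before `Tₙ` (`MpK_le_massBdK_of_lt_locTimeK`).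

## References

* [LSW] Prop. 5.3 (§5), Thm. 6.5 (§6), (7.2). [LawlerSchrammWerner2003Restriction]
* I. Karatzas, S. Shreve, *Brownian Motion and Stochastic Calculus* (1991), Prop. 1.1.13.
-/

noncomputable section

open Set Filter Metric Function MeasureTheory
open _root_.Complex _root_.Topology
open Literature.Probability.Process (brownian preWienerMeasure)
open Literature.Analysis.FunctionSpaces (timeIntegral trunc)
open scoped NNReal

namespace Literature.Probability.RandomPlanarGeometry

open Loewner PathOps

/-! ### The mass functional along a path -/

section Functionals

variable (κ : ℝ≥0) {A : Set ℂ}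

/-- **The Schwarzian mass of the slid hull, `m(A_s − W_s) · 𝟙{alive at s}`, along a path**
(`m = starBubbleMass`, the integrand of the compensator of [LSW] Prop. 5.3).
[cite: LawlerSchrammWerner2003Restriction, Prop. 5.3 (the compensator) with (7.2)] -/
def MFnK (A : Set ℂ) (s : ℝ≥0) (υ : C(ℝ≥0, ℝ)) : ℝ :=
  {υ : C(ℝ≥0, ℝ) | Disjoint (closedHull (drvK κ υ) s) A}.indicator
    (fun υ ↦ starBubbleMass (slidHull (drvK κ υ) A s)) υ

variable {κ}

/-- At an alive time, `MFnK = m(A_s − W_s)`. [folklore] -/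
theorem MFnK_of_alive {s : ℝ≥0} {υ : C(ℝ≥0, ℝ)} (h : Disjoint (closedHull (drvK κ υ) s) A) :
    MFnK κ A s υ = starBubbleMass (slidHull (drvK κ υ) A s) := by
  rw [MFnK, Set.indicator_of_mem]; exact h

/-- After the death time, `MFnK = 0`. [folklore] -/
theorem MFnK_of_not_alive {s : ℝ≥0} {υ : C(ℝ≥0, ℝ)} (h : ¬ Disjoint (closedHull (drvK κ υ) s) A) :
    MFnK κ A s υ = 0 := by
  rw [MFnK, Set.indicator_of_notMem]; exact h

/-- **`MFnK ≥ 0`.** [cite: LawlerSchrammWerner2003Restriction, (5.1)] -/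
theorem MFnK_nonneg (hA : IsStarHull A) (s : ℝ≥0) (υ : C(ℝ≥0, ℝ)) : 0 ≤ MFnK κ A s υ := by
  by_cases h : Disjoint (closedHull (drvK κ υ) s) A
  · rw [MFnK_of_alive h]
    exact starBubbleMass_nonneg_of_isStarHull (Loewner.isStarHull_slidHull_of_disjoint (continuous_drvK κ υ) hA h)
  · rw [MFnK_of_not_alive h]

/-- **Right-continuity in time of the mass functional, for every path.** At a dead time the
functional vanishes from then on (the hulls grow); at an alive time `s`, with `B = A_s − W_s` a
`*`-hull off `B(0, 8ρ₀)` and `δ₀ = Φ_B′(0)`, for small `u` the driver increment after `s` is small,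
the path is still alive at `s + u` (`disjoint_closedHull_add`), `A_{s+u} − W_{s+u}` is the one-step
image of `B` (`slidHull_add_eq`), and `|m(B′) − m(B)| ≤ massStepC δ₀ ρ₀ (u + η)`
(`abs_schwarzMass_slidHull_sub_le`). [cite: LawlerSchrammWerner2003Restriction, §5 (t < T, continuity of the jets of h_t)] -/
theorem continuousWithinAt_MFnK (hA : IsStarHull A) (hne : A.Nonempty) (υ : C(ℝ≥0, ℝ)) (s : ℝ≥0) :
    ContinuousWithinAt (fun r ↦ MFnK κ A r υ) (Ici s) s := by
  set W := drvK κ υ with hWdef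
  have hWc : Continuous W := continuous_drvK κ υ
  by_cases halive : Disjoint (closedHull W s) A
  swap
  · -- dead at `s`: identically `0` on `[s, ∞)`
    have h0 : ∀ r ∈ Ici s, MFnK κ A r υ = 0 := fun r hr ↦
      MFnK_of_not_alive fun h ↦ halive (h.mono_left (closedHull_mono W hr))
    exact (continuousWithinAt_const (b := (0 : ℝ))).congr h0 (h0 s Set.self_mem_Ici)
  -- alive at `s`
  set B := slidHull W A s with hBdef
  have hB : IsStarHull B := Loewner.isStarHull_slidHull_of_disjoint hWc hA halive
  have hBne : B.Nonempty := hne.image _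
  obtain ⟨hm0, -⟩ := infDist_zero_pos hB hBne
  set ρ₀ : ℝ := infDist 0 B / 8 with hρ₀def
  have hρ₀ : 0 < ρ₀ := by positivity
  have hBρ : Disjoint (ball (0 : ℂ) (8 * ρ₀)) B := by
    rw [show 8 * ρ₀ = infDist 0 B by rw [hρ₀def]; ring]
    exact disjoint_ball_infDist
  obtain ⟨hd0, hd1, -⟩ := starDeriv_spec hB
  set δ₀ : ℝ := starDeriv B with hδ₀def
  set C : ℝ := massStepC δ₀ ρ₀ with hCdef
  have hC0 : 0 ≤ C := massStepC_nonneg hd0 hρ₀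
  have hC1 : 0 < C + 1 := by linarith
  rw [Metric.continuousWithinAt_iff]
  intro ε hε
  -- the size of the driver increments allowed
  set ε₁ : ℝ := min (δ₀ * ρ₀ / 2000) (ε / (3 * (C + 1))) with hε₁def
  have hε₁ : 0 < ε₁ := lt_min (by positivity) (by positivity)
  obtain ⟨τ, hτ, hτW⟩ := Metric.continuousAt_iff.1 (hWc.continuousAt (x := s)) ε₁ hε₁
  -- the size of the time steps allowed
  set h₀ : ℝ := min (ε / (3 * (C + 1))) (min ((ε / (12 * (C + 1))) ^ 2) ((δ₀ * ρ₀ / 8000) ^ 2)) with hh₀def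
  have hh₀ : 0 < h₀ := lt_min (by positivity) (lt_min (by positivity) (by positivity))
  refine ⟨min τ h₀, lt_min hτ hh₀, fun r hr hdist ↦ ?_⟩
  obtain ⟨h, rfl⟩ : ∃ h : ℝ≥0, r = s + h := ⟨r - s, (add_tsub_cancel_of_le hr).symm⟩
  have hdisth : dist (s + h) s = (h : ℝ) := by
    rw [NNReal.dist_eq, NNReal.coe_add, add_sub_cancel_left, abs_of_nonneg h.coe_nonneg]
  rw [hdisth] at hdist
  have hhτ : (h : ℝ) < τ := lt_of_lt_of_le hdist (min_le_left _ _)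
  have hhh₀ : (h : ℝ) < h₀ := lt_of_lt_of_le hdist (min_le_right _ _)
  rcases eq_or_lt_of_le (show (0 : ℝ≥0) ≤ h from bot_le) with hzero | hpos
  · rw [← hzero, add_zero, dist_self]; exact hε
  -- the driver increment after `s` is at most `ε₁` on `[0, h]`
  have hS : ∀ v : ℝ≥0, v ≤ h → |W (s + v) - W s| ≤ ε₁ := by
    intro v hv
    have hdv : dist (s + v) s < τ := by
      rw [NNReal.dist_eq, NNReal.coe_add, add_sub_cancel_left, abs_of_nonneg v.coe_nonneg]
      exact lt_of_le_of_lt (NNReal.coe_le_coe.2 hv) hhτ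
    have := hτW hdv
    rw [Real.dist_eq] at this
    exact this.le
  -- the step-size constraints
  have hsqrt1 : Real.sqrt h < ε / (12 * (C + 1)) := by
    have h1 : (h : ℝ) < (ε / (12 * (C + 1))) ^ 2 := hhh₀.trans_le ((min_le_right _ _).trans (min_le_left _ _))
    calc Real.sqrt h < Real.sqrt ((ε / (12 * (C + 1))) ^ 2) := Real.sqrt_lt_sqrt h.coe_nonneg h1
      _ = ε / (12 * (C + 1)) := Real.sqrt_sq (by positivity)
  have hsqrt2 : Real.sqrt h < δ₀ * ρ₀ / 8000 := by
    have h1 : (h : ℝ) < (δ₀ * ρ₀ / 8000) ^ 2 := hhh₀.trans_le ((min_le_right _ _).trans (min_le_right _ _))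
    calc Real.sqrt h < Real.sqrt ((δ₀ * ρ₀ / 8000) ^ 2) := Real.sqrt_lt_sqrt h.coe_nonneg h1
      _ = δ₀ * ρ₀ / 8000 := Real.sqrt_sq (by positivity)
  have hε₁a : ε₁ ≤ δ₀ * ρ₀ / 2000 := min_le_left _ _
  have hε₁b : ε₁ ≤ ε / (3 * (C + 1)) := min_le_right _ _
  have hha : (h : ℝ) ≤ ε / (3 * (C + 1)) := hhh₀.le.trans (min_le_left _ _)
  have hη : stepSize ε₁ h ≤ starDeriv B * ρ₀ / 1000 := by
    rw [stepSize]; rw [hδ₀def] at hε₁a hsqrt2; linarith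
  have hηρ : stepSize ε₁ h ≤ ρ₀ := by
    refine hη.trans ?_
    rw [div_le_iff₀ (by norm_num : (0 : ℝ) < 1000)]
    nlinarith
  have hh4 : (h : ℝ) ≤ (ρ₀ / 4) ^ 2 := by
    have h1 : (h : ℝ) < (δ₀ * ρ₀ / 8000) ^ 2 := hhh₀.trans_le ((min_le_right _ _).trans (min_le_right _ _))
    have h2 : (δ₀ * ρ₀ / 8000) ^ 2 ≤ (ρ₀ / 4) ^ 2 := by
      apply pow_le_pow_left₀ (by positivity)
      rw [div_le_div_iff₀ (by norm_num) (by norm_num)]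
      nlinarith
    exact h1.le.trans h2
  -- alive at `s + h`, and the semigroup identity
  have halive' : Disjoint (closedHull W (s + h)) A := disjoint_closedHull_add hWc hA halive hρ₀ hBρ hpos hS hηρ hh4
  have hadd : slidHull W A (s + h) = slidHull (fun r ↦ W (s + r) - W s) B h :=
    slidHull_add_eq hWc hA halive hρ₀ hBρ hpos hS hηρ hh4
  -- the one-step bound
  have hU : Continuous fun r : ℝ≥0 ↦ W (s + r) - W s := (hWc.comp (continuous_const.add continuous_id)).sub continuous_const
  have hU0 : W (s + 0) - W s = 0 := by simp
  have key := abs_schwarzMass_slidHull_sub_le hB hU hU0 hpos hS hρ₀ hBρ hη hd0 le_rfl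
  rw [Real.dist_eq, MFnK_of_alive halive', MFnK_of_alive halive, hadd]
  refine lt_of_le_of_lt key ?_
  -- `C (h + ε₁ + 4√h) < ε`
  have hsum : (h : ℝ) + stepSize ε₁ h ≤ ε / (C + 1) := by
    rw [stepSize]
    have : ε / (C + 1) = ε / (3 * (C + 1)) + ε / (3 * (C + 1)) + 4 * (ε / (12 * (C + 1))) := by
      field_simp; ring
    rw [this]; linarith
  calc C * (h + stepSize ε₁ h) ≤ C * (ε / (C + 1)) := mul_le_mul_of_nonneg_left hsum hC0
    _ < ε := by rw [mul_div_assoc', div_lt_iff₀ hC1]; nlinarith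

end Functionals

/-! ### Measurability of the mass functional on path space -/

section PathMeasurable

variable [MeasurableSpace C(ℝ≥0, ℝ)] [BorelSpace C(ℝ≥0, ℝ)] {κ : ℝ≥0} {A : Set ℂ}

/-- **`MFnK κ A s` is a measurable functional of the path** (`TranslatedHullJets`).
[cite: LawlerSchrammWerner2003Restriction, Prop. 5.3 (the compensator ∫ Sh_s(W_s)/6 ds)] -/
theorem measurable_MFnK (hA : IsStarHull A) (hne : A.Nonempty) (s : ℝ≥0) : Measurable (MFnK κ A s) :=
  measurable_indicator_schwarzMass_slidHull (W := fun υ : C(ℝ≥0, ℝ) ↦ drvK κ υ) (t := s)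
    (fun υ ↦ continuous_drvK κ υ) (drvK_zero κ) (fun r _ ↦ measurable_drvK_apply κ r) hA hne

end PathMeasurable

/-! ### The mass process on the Wiener space: adapted, right-continuous, progressive -/

section Processes

variable (κ : ℝ≥0) {A : Set ℂ}

/-- **The mass process `m_t(ω) = 𝟙{alive} m(A_t − W_t)` of SLE_κ on the canonical space.**
[cite: LawlerSchrammWerner2003Restriction, Prop. 5.3 (the compensator)] -/
def MpK (A : Set ℂ) (s : ℝ≥0) (ω : ℝ≥0 → ℝ) : ℝ := MFnK κ A s (brownianCPath ω)

variable {κ}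

/-- `MpK ≥ 0`. [folklore] -/
theorem MpK_nonneg (hA : IsStarHull A) (s : ℝ≥0) (ω : ℝ≥0 → ℝ) : 0 ≤ MpK κ A s ω := MFnK_nonneg hA s _

/-- **The mass process is adapted** to the Brownian filtration. [folklore] -/
theorem adapted_MpK (hA : IsStarHull A) (hne : A.Nonempty) : Adapted brownianFiltration (MpK κ A) := fun t ↦
  measurable_indicator_schwarzMass_slidHull (mΩ := brownianFiltration t) (W := fun ω : ℝ≥0 → ℝ ↦ drvK κ (brownianCPath ω))
    (t := t) (fun _ ↦ continuous_drvK κ _) (fun _ ↦ drvK_zero κ _) (fun _ hs ↦ measurable_drvK_brownianCPath_of_le hs) hA hne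

/-- **The mass process has right-continuous paths.** [folklore] -/
theorem continuousWithinAt_MpK (hA : IsStarHull A) (hne : A.Nonempty) (ω : ℝ≥0 → ℝ) (t : ℝ≥0) :
    ContinuousWithinAt (MpK κ A · ω) (Ici t) t :=
  continuousWithinAt_MFnK hA hne (brownianCPath ω) t

/-- **The mass process is (strongly) progressively measurable** (adapted with right-continuous
paths; Karatzas–Shreve Prop. 1.1.13). [folklore] -/
theorem isStronglyProgressive_MpK (hA : IsStarHull A) (hne : A.Nonempty) :
    IsStronglyProgressive brownianFiltration (MpK κ A) :=
  Literature.Probability.Process.isStronglyProgressive_of_rightContinuous (adapted_MpK hA hne)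
    fun ω t ↦ continuousWithinAt_MpK hA hne ω t

/-- **The paths of a progressive real process are measurable** (sections of the jointly measurable
restrictions to `[0, i] × Ω`, `i → ∞`). [folklore] -/
theorem _root_.MeasureTheory.IsStronglyProgressive.measurable_path {Ω : Type*} {m : MeasurableSpace Ω}
    {𝓕 : Filtration ℝ≥0 m} {g : ℝ≥0 → Ω → ℝ} (hg : IsStronglyProgressive 𝓕 g) (ω : Ω) :
    Measurable fun s ↦ g s ω := by
  -- `s ↦ g (min s n) ω` is measurable for every `n`, and converges to `g s ω`
  have hn : ∀ n : ℕ, Measurable fun s : ℝ≥0 ↦ g (min s n) ω := by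
    intro n
    have h1 := (hg (n : ℝ≥0)).measurable
    have h2 : @Measurable (Set.Iic (n : ℝ≥0)) (Set.Iic (n : ℝ≥0) × Ω) _
        (MeasurableSpace.prod Subtype.instMeasurableSpace (𝓕 n)) fun s ↦ (s, ω) := by
      letI : MeasurableSpace Ω := 𝓕 n
      exact measurable_id.prodMk measurable_const
    have h3 : Measurable fun s : ℝ≥0 ↦ (⟨min s n, Set.mem_Iic.2 (min_le_right _ _)⟩ : Set.Iic (n : ℝ≥0)) :=
      (measurable_id.min measurable_const).subtype_mk
    exact (h1.comp h2).comp h3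
  refine measurable_of_tendsto_metrizable hn (tendsto_pi_nhds.2 fun s ↦ ?_)
  refine tendsto_const_nhds.congr' ?_
  filter_upwards [eventually_ge_atTop (Nat.ceil (s : ℝ))] with n hn
  have hsn : s ≤ (n : ℝ≥0) := by
    have h1 : (s : ℝ) ≤ (Nat.ceil (s : ℝ) : ℝ) := Nat.le_ceil _
    have h2 : (Nat.ceil (s : ℝ) : ℝ) ≤ n := by exact_mod_cast hn
    exact NNReal.coe_le_coe.1 (by push_cast; linarith)
  rw [min_eq_left hsn]

/-- The paths of the mass process are measurable. [folklore] -/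
theorem measurable_MpK_path (hA : IsStarHull A) (hne : A.Nonempty) (ω : ℝ≥0 → ℝ) :
    Measurable fun s ↦ MpK κ A s ω :=
  (isStronglyProgressive_MpK hA hne).measurable_path ω

/-! ### The bound before the localising time -/

/-- **The constant bounding the mass before `Tₙ`**: `1/(4c²(c/8)²) + 1/(3c(c/8)²)` at `c = locLevel n`
(`Φ′ ≥ c`, `dist(0, A_t − W_t) ≥ c`), i.e. `massBound c (c/8)`. [folklore] -/
def massBdK (c : ℝ) : ℝ := massBound c (c / 8)

/-- `0 ≤ massBdK c` for `c > 0`. [folklore] -/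
theorem massBdK_nonneg {c : ℝ} (hc : 0 < c) : 0 ≤ massBdK c := by rw [massBdK, massBound]; positivity

variable {hA : IsStarHull A} {hne : A.Nonempty}

/-- **Before `Tₙ`, `0 ≤ m_t ≤ massBdK (locLevel n)`.** [folklore] -/
theorem MpK_le_massBdK_of_lt_locTimeK {n : ℕ} {t : ℝ≥0} {ω : ℝ≥0 → ℝ}
    (ht : (t : WithTop ℝ≥0) < locTimeK κ hA hne n ω) : MpK κ A t ω ≤ massBdK (locLevel n) := by
  obtain ⟨halive, -, -, hD, hdist⟩ := controlled_of_lt_locTimeK ht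
  obtain ⟨hc0, -⟩ := locLevel_pos_le n
  have hB : IsStarHull (slidHull (drvK κ (brownianCPath ω)) A t) :=
    Loewner.isStarHull_slidHull_of_disjoint (continuous_drvK κ _) hA halive
  have hBρ : Disjoint (ball (0 : ℂ) (8 * (locLevel n / 8))) (slidHull (drvK κ (brownianCPath ω)) A t) := by
    rw [show 8 * (locLevel n / 8) = locLevel n by ring]
    exact disjoint_ball_infDist.mono_left (ball_subset_ball hdist.le)
  rw [MpK, MFnK_of_alive halive, massBdK]
  exact starBubbleMass_le_of_control hB hc0 (by positivity) hD.le hBρ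

/-! ### The stopped compensator `∫₀ᵗ 𝟙{s ≤ Tₙ} m_s ds` -/

variable (κ hA hne) in
/-- **The compensator integral stopped at the localising time**:
`IpnK n t ω = ∫₀ᵗ 𝟙{s ≤ Tₙ(ω)} m(A_s − W_s) ds` (`timeIntegral` of the truncated mass process).
[cite: LawlerSchrammWerner2003Restriction, Prop. 5.3 (∫₀ᵗ Sh_s(W_s)/6 ds, t < T)] -/
def IpnK (n : ℕ) : ℝ≥0 → (ℝ≥0 → ℝ) → ℝ := timeIntegral (trunc (locTimeK κ hA hne n) (MpK κ A))

/-- **The stopped compensator is adapted** (the truncated mass process is progressive; Fubini).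
[folklore] -/
theorem adapted_IpnK (n : ℕ) : Adapted brownianFiltration (IpnK κ hA hne n) :=
  Literature.Analysis.FunctionSpaces.adapted_timeIntegral
    (Literature.Analysis.FunctionSpaces.isStronglyProgressive_trunc (isStronglyProgressive_MpK hA hne)
      fun t ↦ (isStoppingTime_locTimeK n).measurableSet_lt t)

/-- The truncated mass `𝟙{s ≤ Tₙ} m_s` is an indicator in time. [folklore] -/
theorem trunc_MpK_eq_indicator (n : ℕ) (ω : ℝ≥0 → ℝ) (s : ℝ≥0) :
    trunc (locTimeK κ hA hne n) (MpK κ A) s ω =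
      {s : ℝ≥0 | (s : WithTop ℝ≥0) ≤ locTimeK κ hA hne n ω}.indicator (fun s ↦ MpK κ A s ω) s := by
  simp only [Literature.Analysis.FunctionSpaces.trunc_apply, Set.indicator_apply, Set.mem_setOf_eq]

/-- The time set `{s | s ≤ Tₙ(ω)}` is measurable. [folklore] -/
theorem measurableSet_le_locTimeK (n : ℕ) (ω : ℝ≥0 → ℝ) :
    MeasurableSet {s : ℝ≥0 | (s : WithTop ℝ≥0) ≤ locTimeK κ hA hne n ω} := by
  cases h : locTimeK κ hA hne n ω with
  | top => simp
  | coe τ =>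
    have : {s : ℝ≥0 | (s : WithTop ℝ≥0) ≤ (τ : WithTop ℝ≥0)} = Iic τ := by
      ext s; simp only [mem_setOf_eq, mem_Iic, WithTop.coe_le_coe]
    rw [this]; exact measurableSet_Iic

/-- `0 ≤ 𝟙{s ≤ Tₙ} m_s`. [folklore] -/
theorem trunc_MpK_nonneg (hA' : IsStarHull A) (n : ℕ) (s : ℝ≥0) (ω : ℝ≥0 → ℝ) :
    0 ≤ trunc (locTimeK κ hA hne n) (MpK κ A) s ω := by
  rw [Literature.Analysis.FunctionSpaces.trunc_apply]
  split_ifs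
  · exact MpK_nonneg hA' s ω
  · exact le_rfl

/-- The truncated integrand, as a function of real time, is measurable for every path. [folklore] -/
theorem measurable_trunc_MpK (n : ℕ) (ω : ℝ≥0 → ℝ) :
    Measurable fun s : ℝ ↦ trunc (locTimeK κ hA hne n) (MpK κ A) s.toNNReal ω := by
  have h1 : Measurable fun s : ℝ≥0 ↦ trunc (locTimeK κ hA hne n) (MpK κ A) s ω := by
    have heq : (fun s : ℝ≥0 ↦ trunc (locTimeK κ hA hne n) (MpK κ A) s ω) =
        {s : ℝ≥0 | (s : WithTop ℝ≥0) ≤ locTimeK κ hA hne n ω}.indicator fun s ↦ MpK κ A s ω :=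
      funext (trunc_MpK_eq_indicator n ω)
    rw [heq]
    exact (measurable_MpK_path hA hne ω).indicator (measurableSet_le_locTimeK n ω)
  exact h1.comp measurable_real_toNNReal

/-- **The truncated mass is bounded by `massBdK (locLevel n)` at every real time `s ≥ 0` other than
`Tₙ`** (before `Tₙ`: the control; after: `0`; negative times read as `0`). [folklore] -/
theorem norm_trunc_MpK_le (n : ℕ) (ω : ℝ≥0 → ℝ) {s : ℝ}
    (hs : ((s.toNNReal : ℝ≥0) : WithTop ℝ≥0) ≠ locTimeK κ hA hne n ω) :
    ‖trunc (locTimeK κ hA hne n) (MpK κ A) s.toNNReal ω‖ ≤ massBdK (locLevel n) := by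
  have hM := massBdK_nonneg (locLevel_pos_le n).1
  rw [Real.norm_eq_abs, Literature.Analysis.FunctionSpaces.trunc_apply]
  split_ifs with hle
  · have hlt : ((s.toNNReal : ℝ≥0) : WithTop ℝ≥0) < locTimeK κ hA hne n ω := lt_of_le_of_ne hle hs
    rw [abs_of_nonneg (MpK_nonneg hA _ ω)]
    exact MpK_le_massBdK_of_lt_locTimeK hlt
  · rw [abs_zero]; exact hM

/-- Off the (at most one) real time `Tₙ ≥ 0`: almost every real time is not `Tₙ`. [folklore] -/
theorem ae_toNNReal_ne_locTimeK (n : ℕ) (ω : ℝ≥0 → ℝ) :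
    ∀ᵐ s : ℝ ∂volume, 0 ≤ s → ((s.toNNReal : ℝ≥0) : WithTop ℝ≥0) ≠ locTimeK κ hA hne n ω := by
  cases h : locTimeK κ hA hne n ω with
  | top => exact Eventually.of_forall fun s _ ↦ WithTop.coe_ne_top
  | coe τ =>
    have hne' : ∀ᵐ s : ℝ ∂volume, s ≠ (τ : ℝ) := by
      rw [ae_iff]
      simp only [ne_eq, not_not, setOf_eq_eq_singleton, measure_singleton]
    filter_upwards [hne'] with s hs hs0 heq
    apply hs
    have : s.toNNReal = τ := by exact_mod_cast heq
    rw [← this, Real.coe_toNNReal _ hs0]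

/-- **The truncated mass is integrable on every bounded time interval** (bounded off one point,
measurable). [folklore] -/
theorem integrableOn_trunc_MpK (n : ℕ) (ω : ℝ≥0 → ℝ) (t : ℝ≥0) :
    IntegrableOn (fun s : ℝ ↦ trunc (locTimeK κ hA hne n) (MpK κ A) s.toNNReal ω) (Icc 0 t) := by
  refine Measure.integrableOn_of_bounded (M := massBdK (locLevel n)) measure_Icc_lt_top.ne
    (measurable_trunc_MpK n ω).aestronglyMeasurable ?_
  filter_upwards [ae_restrict_mem measurableSet_Icc, ae_restrict_of_ae (ae_toNNReal_ne_locTimeK n ω)] with s hs hsT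
  exact norm_trunc_MpK_le n ω (hsT hs.1)

/-- The stopped compensator as a set integral over `(0, t]`. [folklore] -/
theorem IpnK_eq_setIntegral (n : ℕ) (t : ℝ≥0) (ω : ℝ≥0 → ℝ) :
    IpnK κ hA hne n t ω = ∫ s in Ioc (0 : ℝ) t, trunc (locTimeK κ hA hne n) (MpK κ A) s.toNNReal ω := by
  show ∫ s in (0 : ℝ)..(t : ℝ), trunc (locTimeK κ hA hne n) (MpK κ A) s.toNNReal ω = _
  exact intervalIntegral.integral_of_le t.coe_nonneg

/-- `IpnK n 0 = 0`. [folklore] -/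
@[simp] theorem IpnK_zero (n : ℕ) (ω : ℝ≥0 → ℝ) : IpnK κ hA hne n 0 ω = 0 :=
  Literature.Analysis.FunctionSpaces.timeIntegral_apply_zero _ ω

/-- **The stopped compensator has continuous paths.** [folklore] -/
theorem continuous_IpnK (n : ℕ) (ω : ℝ≥0 → ℝ) : Continuous fun t ↦ IpnK κ hA hne n t ω :=
  Literature.Analysis.FunctionSpaces.continuous_timeIntegral fun t ↦ integrableOn_trunc_MpK n ω t

/-- **The stopped compensator is nonnegative.** [folklore] -/
theorem IpnK_nonneg (n : ℕ) (t : ℝ≥0) (ω : ℝ≥0 → ℝ) : 0 ≤ IpnK κ hA hne n t ω := by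
  rw [IpnK_eq_setIntegral]
  exact setIntegral_nonneg measurableSet_Ioc fun s _ ↦ trunc_MpK_nonneg hA n _ ω

/-- **The stopped compensator is monotone in time.** [folklore] -/
theorem IpnK_mono (n : ℕ) (ω : ℝ≥0 → ℝ) : Monotone fun t ↦ IpnK κ hA hne n t ω := by
  intro s t hst
  simp only [IpnK_eq_setIntegral]
  refine setIntegral_mono_set ((integrableOn_trunc_MpK n ω t).mono_set Ioc_subset_Icc_self)
    (Eventually.of_forall fun r ↦ trunc_MpK_nonneg hA n _ ω) (Eventually.of_forall ?_)
  exact fun r hr ↦ ⟨hr.1, hr.2.trans (NNReal.coe_le_coe.2 hst)⟩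

/-- **The stopped compensator is bounded**: `IpnK n t ω ≤ massBdK (locLevel n) · t`. [folklore] -/
theorem IpnK_le (n : ℕ) (t : ℝ≥0) (ω : ℝ≥0 → ℝ) : IpnK κ hA hne n t ω ≤ massBdK (locLevel n) * t := by
  rw [IpnK_eq_setIntegral]
  have hle : ∀ᵐ s ∂volume.restrict (Ioc (0 : ℝ) t),
      trunc (locTimeK κ hA hne n) (MpK κ A) s.toNNReal ω ≤ massBdK (locLevel n) := by
    filter_upwards [ae_restrict_mem measurableSet_Ioc, ae_restrict_of_ae (ae_toNNReal_ne_locTimeK n ω)] with s hs hsT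
    have h := norm_trunc_MpK_le n ω (hsT hs.1.le)
    rw [Real.norm_eq_abs] at h
    exact (le_abs_self _).trans h
  have hint : IntegrableOn (fun s : ℝ ↦ trunc (locTimeK κ hA hne n) (MpK κ A) s.toNNReal ω) (Ioc 0 t) :=
    (integrableOn_trunc_MpK n ω t).mono_set Ioc_subset_Icc_self
  calc ∫ s in Ioc (0 : ℝ) t, trunc (locTimeK κ hA hne n) (MpK κ A) s.toNNReal ω
      ≤ ∫ _ in Ioc (0 : ℝ) t, massBdK (locLevel n) :=
        integral_mono_ae hint (integrableOn_const measure_Ioc_lt_top.ne) hle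
    _ = massBdK (locLevel n) * t := by
        rw [setIntegral_const, measureReal_def, Real.volume_Ioc, sub_zero, ENNReal.toReal_ofReal t.coe_nonneg, smul_eq_mul, mul_comm]

end Processes

end Literature.Probability.RandomPlanarGeometry

end
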